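import Literature.Analysis.FluidPDE.PassiveScalarDiagForcedGrowth
import Literature.Analysis.FluidPDE.PassiveScalarDiagForcedTraceGlobal
import Literature.Analysis.FluidPDE.PassiveScalarDiagEnergyContinuity
import HarnessLib

/-!
# Every-time `L²` bounds along the weakly continuous representative

Analysis/FluidPDE proof-support file (everything proved). The weakly continuous representative
`w` of a weak diagonal-diffusion passive scalar (`PassiveScalarDiagForcedTraceGlobal`: `w(t) ∈ L²`
for every `t ≥ 0`, `t ↦ ∫ w(t) g` continuous for every `g ∈ L²`) turns the a.e.-in-time bounds of
the energy layer into bounds at EVERY time, by the weak lower semicontinuity of the `L²` norm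
(Brezis 2011, Prop. 3.5 (iii)):

* `Torus.sqrt_integral_sq_le_of_ae_le` — for a family `v` with `L²` slices and continuous
  pairings `t ↦ ∫ v(t) g` (`g ∈ L²`) on `[a,b]`, an a.e. bound `‖v(t)‖_{L²} ≤ φ(t)` by a
  continuous `φ` holds at every `t ∈ [a,b]`;
* (strongly `L²`-continuous families have continuous pairings —
  `Torus.IsL2ContinuousOn.continuousOn_integral_mul` of `PassiveScalarDiagEnergyContinuity` — so
  differences `w - θʰ` with an `L²`-continuous `θʰ` are again admissible);
* `Torus.IsWeakScalarTransportDiagForced.sqrt_integral_sq_translate_le` — for `κ > 0`, `aᵢ > 0`,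
  a bounded drift and a source with `‖s(t)‖_{L²} ≤ M` at every time, a representative `w` which
  restarts from its own slices (`exists_weaklyContinuous_representative`) satisfies
  `‖w(σ + t)‖_{L²} ≤ ‖w(σ)‖_{L²} + M t` for EVERY `σ, t ≥ 0` (the a.e. estimate
  `IsWeakScalarTransportDiagForcedOn.ae_sqrt_integral_sq_le` of the restarted solution, upgraded).

## Mathlib / tree search

Tree: `IsWeakScalarTransportDiagForcedOn.ae_sqrt_integral_sq_le` (`PassiveScalarDiagForcedGrowth`),
`IsWeakScalarTransportDiagForced.exists_weaklyContinuous_representative`, `Torus.IsL2ContinuousOn`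
(`UniversalTotalAnomalousDissipator`), `Torus.IsL2ContinuousOn.continuousOn_integral_mul`
(`PassiveScalarDiagEnergyContinuity`). Mathlib: `Measure.eqOn_Icc_of_ae_eq` (continuous functions
a.e. equal on `[a,b]` are equal — used through `max (F - G) 0`).

## References

* H. Brezis, *Functional Analysis, Sobolev Spaces and PDE* (Springer 2011), Prop. 3.5 (iii)
  (the norm is weakly lower semicontinuous), Prop. 3.5 (iv) (weak × strong pairings converge).
  [`Brezis2011`]
* R. J. DiPerna, P.-L. Lions, Invent. Math. 98 (1989), §II.1, (13) (the `L^∞_t L²_x` estimate).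
  [`DiPernaLions1989`]
-/

noncomputable section

open _root_.MeasureTheory _root_.Set _root_.Filter _root_.Function _root_.TopologicalSpace
open scoped ENNReal NNReal InnerProductSpace Topology

namespace Literature.Analysis.FluidPDE

namespace Torus

open Literature.Analysis.FunctionSpaces.Torus Literature.Analysis.FunctionSpaces

variable {d : Type*} [Fintype d] [DecidableEq d]

/-! ## Tools -/

section Tools

omit [Fintype d] [DecidableEq d] in
/-- Two functions continuous on `[a,b]` (`a < b`) with `F ≤ G` a.e. on `[a,b]` satisfy `F ≤ G`
everywhere on `[a,b]` (apply `Measure.eqOn_Icc_of_ae_eq` to `max (F - G) 0` and `0`). [folklore] -/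
private theorem le_of_ae_le_of_continuousOn_Icc {F G : ℝ → ℝ} {a b : ℝ} (hab : a < b)
    (hF : ContinuousOn F (Icc a b)) (hG : ContinuousOn G (Icc a b))
    (h : ∀ᵐ t ∂(volume.restrict (Icc a b)), F t ≤ G t) : ∀ t ∈ Icc a b, F t ≤ G t := by
  have hc : ContinuousOn (fun t => max (F t - G t) 0) (Icc a b) :=
    (continuous_id.max continuous_const).comp_continuousOn (hF.sub hG)
  have hae : (fun t => max (F t - G t) 0) =ᵐ[volume.restrict (Icc a b)] fun _ => (0 : ℝ) := by
    filter_upwards [h] with t ht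
    exact max_eq_right (by linarith)
  have heq := Measure.eqOn_Icc_of_ae_eq (μ := volume) hab.ne hae hc continuousOn_const
  intro t ht
  have := heq ht
  simp only at this
  have h1 : F t - G t ≤ 0 := by
    have := le_max_left (F t - G t) 0
    rw [‹max (F t - G t) 0 = 0›] at this
    exact this
  linarith

omit [DecidableEq d] in
/-- Cauchy–Schwarz in `L²(T^d)`: `|∫ f g| ≤ √(∫ f²) √(∫ g²)`. [folklore] -/
private theorem abs_integral_mul_le_sqrt {f g : UnitAddTorus d → ℝ} (hf : MemLp f 2 volume)
    (hg : MemLp g 2 volume) :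
    |∫ x, f x * g x| ≤ Real.sqrt (∫ x, f x ^ 2) * Real.sqrt (∫ x, g x ^ 2) := by
  -- adapted from `Torus.DEIJ.abs_integral_mul_le_sqrt` (DEIJCriterion.lean)
  have hf' : MemLp f (ENNReal.ofReal 2) volume := by rwa [ENNReal.ofReal_ofNat]
  have hg' : MemLp g (ENNReal.ofReal 2) volume := by rwa [ENNReal.ofReal_ofNat]
  have h := integral_mul_norm_le_Lp_mul_Lq (μ := volume) Real.HolderConjugate.two_two hf' hg'
  have e2 : ∀ (w : UnitAddTorus d → ℝ), (∫ a, ‖w a‖ ^ (2 : ℝ)) ^ (1 / (2 : ℝ)) = Real.sqrt (∫ a, w a ^ 2) := by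
    intro w
    rw [Real.sqrt_eq_rpow]
    congr 1
    refine integral_congr_ae (Eventually.of_forall fun a => ?_)
    dsimp only
    rw [Real.rpow_two, Real.norm_eq_abs, sq_abs]
  rw [e2, e2] at h
  refine le_trans ?_ h
  calc |∫ x, f x * g x| ≤ ∫ x, |f x * g x| := abs_integral_le_integral_abs
    _ = ∫ x, ‖f x‖ * ‖g x‖ := integral_congr_ae (Eventually.of_forall fun x => by
        simp [abs_mul, Real.norm_eq_abs])

end Tools

/-! ## Weak lower semicontinuity: a.e. bounds hold at every time -/

omit [DecidableEq d] in
/-- **An a.e. `L²` bound along a weakly continuous family holds at every time.** Let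
`v : ℝ → (T^d → ℝ)` have `L²` slices on `[a,b]` (`a < b`) and continuous pairings
`t ↦ ∫ v(t) g` on `[a,b]` for every `g ∈ L²(T^d)` (a `C([a,b]; L²_w)` family), and let `φ` be
continuous on `[a,b]` with `‖v(t)‖_{L²} ≤ φ(t)` for a.e. `t ∈ [a,b]`. Then `‖v(t)‖_{L²} ≤ φ(t)`
for EVERY `t ∈ [a,b]`: testing against `g = v(t₀)`, the continuous function
`t ↦ ∫ v(t) v(t₀) - φ(t) ‖v(t₀)‖` is `≤ 0` a.e. (Cauchy–Schwarz), hence at `t₀` — the weak lower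
semicontinuity of the norm (Brezis 2011, Prop. 3.5 (iii)) in the form needed for traces.
[cite: Brezis2011, Prop. 3.5 (iii)] -/
theorem sqrt_integral_sq_le_of_ae_le {v : ℝ → UnitAddTorus d → ℝ} {φ : ℝ → ℝ} {a b : ℝ}
    (hab : a < b) (hv2 : ∀ t ∈ Icc a b, MemLp (v t) 2 volume)
    (hvc : ∀ g : UnitAddTorus d → ℝ, MemLp g 2 volume → ContinuousOn (fun t => ∫ x, v t x * g x) (Icc a b))
    (hφ : ContinuousOn φ (Icc a b))
    (hle : ∀ᵐ t ∂(volume.restrict (Icc a b)), Real.sqrt (∫ x, v t x ^ 2) ≤ φ t) :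
    ∀ t ∈ Icc a b, Real.sqrt (∫ x, v t x ^ 2) ≤ φ t := by
  intro t₀ ht₀
  set g : UnitAddTorus d → ℝ := v t₀ with hg
  have hg2 : MemLp g 2 volume := hv2 t₀ ht₀
  set N : ℝ := Real.sqrt (∫ x, g x ^ 2) with hN
  have hN0 : 0 ≤ N := Real.sqrt_nonneg _
  -- `φ ≥ 0` at `t₀`
  have hφ0 : 0 ≤ φ t₀ := by
    have := le_of_ae_le_of_continuousOn_Icc hab continuousOn_const hφ
      (hle.mono fun t ht => (Real.sqrt_nonneg _).trans ht)
    exact this t₀ ht₀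
  -- the continuous test function `t ↦ ∫ v(t) g - φ(t) N` is `≤ 0` a.e., hence at `t₀`
  have hF : ContinuousOn (fun t => ∫ x, v t x * g x) (Icc a b) := hvc g hg2
  have hG : ContinuousOn (fun t => φ t * N) (Icc a b) := hφ.mul continuousOn_const
  have hae : ∀ᵐ t ∂(volume.restrict (Icc a b)), (∫ x, v t x * g x) ≤ φ t * N := by
    filter_upwards [hle, ae_restrict_mem measurableSet_Icc] with t ht htI
    calc ∫ x, v t x * g x ≤ Real.sqrt (∫ x, v t x ^ 2) * Real.sqrt (∫ x, g x ^ 2) :=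
          (le_abs_self _).trans (abs_integral_mul_le_sqrt (hv2 t htI) hg2)
      _ ≤ φ t * N := mul_le_mul_of_nonneg_right ht hN0
  have key := le_of_ae_le_of_continuousOn_Icc hab hF hG hae t₀ ht₀
  -- at `t₀`: `N² ≤ φ(t₀) N`
  have hsq : ∫ x, v t₀ x * g x = N ^ 2 := by
    rw [hN, Real.sq_sqrt (integral_nonneg fun x => sq_nonneg _)]
    exact integral_congr_ae (Eventually.of_forall fun x => by simp [hg, sq])
  simp only [hsq] at key
  change N ≤ φ t₀
  rcases hN0.eq_or_lt with h0 | hpos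
  · rw [← h0]; exact hφ0
  · nlinarith

/-! ## Linear growth at every time along the representative -/

namespace IsWeakScalarTransportDiagForced

variable {κ : ℝ} {a : d → ℝ} {u : ℝ → UnitAddTorus d → EuclideanSpace ℝ d}
  {s : ℝ → UnitAddTorus d → ℝ}

/-- **Linear `L²` growth at EVERY time along a representative which restarts from its own
slices.** Let `κ > 0`, `aᵢ > 0`, let the drift be bounded (`‖u(t,x)‖ ≤ A`) and the source have
`s(t) ∈ L²`, `‖s(t)‖²_{L²} ≤ M²` at every time (`M ≥ 0`). If `w` has `L²` slices and continuous
pairings `t ↦ ∫ w(t) g` (`g ∈ L²`) on `[0,∞)`, and `t ↦ w(σ + t)` is a global weak solution with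
drift `u(σ + ·)`, source `s(σ + ·)` and datum `w(σ)` for every `σ ≥ 0` (the representative of
`exists_weaklyContinuous_representative`), then
`‖w(σ + t)‖_{L²} ≤ ‖w(σ)‖_{L²} + M t` for all `σ, t ≥ 0` — the `L^∞_t L²_x` estimate of
DiPerna–Lions 1989, §II.1 (13), at every time (`ae_sqrt_integral_sq_le` + weak lower
semicontinuity `sqrt_integral_sq_le_of_ae_le`). [cite: DiPernaLions1989, §II.1 (13)] -/
theorem sqrt_integral_sq_translate_le (hκ : 0 < κ) (ha : ∀ i, 0 < a i)
    {A : ℝ} (huA : ∀ t x, ‖u t x‖ ≤ A) {M : ℝ} (hM : 0 ≤ M)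
    (hs2 : ∀ t, MemLp (s t) 2 volume) (hsM : ∀ t, ∫ x, s t x ^ 2 ≤ M ^ 2)
    {w : ℝ → UnitAddTorus d → ℝ} (hw2 : ∀ t, 0 ≤ t → MemLp (w t) 2 volume)
    (hwc : ∀ g : UnitAddTorus d → ℝ, MemLp g 2 volume → ContinuousOn (fun t => ∫ x, w t x * g x) (Ici 0))
    (hrest : ∀ σ, 0 ≤ σ → IsWeakScalarTransportDiagForced a κ (fun t => u (σ + t)) (fun t => s (σ + t))
      (w σ) (fun t => w (σ + t)))
    {σ t : ℝ} (hσ : 0 ≤ σ) (ht : 0 ≤ t) :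
    Real.sqrt (∫ x, w (σ + t) x ^ 2) ≤ Real.sqrt (∫ x, w σ x ^ 2) + M * t := by
  set T : ℝ := t + 1 with hT
  have hT0 : 0 < T := by rw [hT]; linarith
  have hsol := hrest σ hσ T hT0
  -- the restarted drift is bounded, hence in `L^∞((0,T) × T^d)`
  have hu : MemLp (stLift fun τ => u (σ + τ)) ⊤ (volume.restrict (Ioo 0 T ×ˢ univ)) :=
    memLp_top_of_bound hsol.aestronglyMeasurable_velocity A (Eventually.of_forall fun p => by
      obtain ⟨τ, y⟩ := p
      simpa only [stLift_apply] using huA (σ + τ) (proj y))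
  have hae := hsol.ae_sqrt_integral_sq_le hκ ha (hw2 σ hσ) hu hM
    (Eventually.of_forall fun τ => hs2 (σ + τ)) (Eventually.of_forall fun τ => hsM (σ + τ))
  -- upgrade to every `τ ∈ [0,T]` by weak lower semicontinuity
  have hae' : ∀ᵐ τ ∂(volume.restrict (Icc 0 T)),
      Real.sqrt (∫ x, w (σ + τ) x ^ 2) ≤ Real.sqrt (∫ x, w σ x ^ 2) + M * τ := by
    rw [← Measure.restrict_congr_set Ioo_ae_eq_Icc]
    exact hae
  have hmaps : MapsTo (fun τ : ℝ => σ + τ) (Icc 0 T) (Ici 0) := fun τ hτ => by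
    simp only [mem_Ici]; linarith [hτ.1]
  have key := sqrt_integral_sq_le_of_ae_le (v := fun τ => w (σ + τ))
    (φ := fun τ => Real.sqrt (∫ x, w σ x ^ 2) + M * τ) hT0
    (fun τ hτ => hw2 (σ + τ) (by linarith [hτ.1]))
    (fun g hg => (hwc g hg).comp (by fun_prop) hmaps)
    (by fun_prop) hae'
  exact key t ⟨ht, by rw [hT]; linarith⟩

end IsWeakScalarTransportDiagForced

end Torus

end Literature.Analysis.FluidPDE

end
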